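import Literature.MathematicalPhysics.QuantumLattice.HubbardModelParticleHoleProofs
import Literature.MathematicalPhysics.QuantumLattice.HubbardWave0LiebProofs
import HarnessLib

/-!
# Joint-sector ground states under a particle–hole PAIR `P H Pᴴ = H' - U N + c` (any finite site set)

Family `hubbard` (topic `MathematicalPhysics/QuantumLattice`); seat `hubbard-downfold-unc-2` (cell `pub/hubbard-downfold`, row
«FILLING direction of BOX → WORD», electron-doped half at `T = 0`). Setting: a finite site set `Λ`, Lieb's particle–hole unitary
`P = particleHole ε` with unimodular phases, and two operators with `P H Pᴴ = H' - U N + c · 1` (the tree's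
`hamiltonian_particleHole_bipartite_holds` / `hamiltonian_particleHole_sameSign` and `particleHole_hubbardTorusTT'` produce exactly this
shape: on the even torus `H = H_L(t, -t', U)`, `H' = H_L(t, t', U)`, `c = U L²`). Recorded, for the joint sectors `(N, S^z = M)`
(`szSector N M`) used by the `T = 0` convention of record (`IsGroundStateInSector`):

* `particleHole_mul_spinZ_mul_conjTranspose` — `P S^z Pᴴ = -S^z`;
* `conjTranspose_particleHole_mulVec_mem_szSector` / `particleHole_mulVec_mem_szSector` — `Pᴴ`, `P` carry `(N, M)` into
  `(2|Λ| - N, -M)`; `star_conjTranspose_particleHole_mulVec_dotProduct` — `Pᴴ` is isometric;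
* `mulVec_conjTranspose_particleHole_mulVec_of_conj`, `re_rayleigh_conjTranspose_particleHole_mulVec_of_conj` — `H (Pᴴψ) =
  Pᴴ(H'ψ) + (c - U N) Pᴴψ` and the Rayleigh quotients shift by `c - U N` on unit `N`-particle vectors;
* `minEnergyOn_szSector_particleHole_of_conj` — `λ_min^H(2|Λ| - N, -M) = λ_min^{H'}(N, M) + (c - U N)` (no Hermiticity: both sides
  are infima over variational sets matched by `Pᴴ`, `OrderIso.map_csInf'`);
* `isGroundStateInSector_conjTranspose_particleHole_mulVec_of_conj` — unit ground states of `H'` in `(N, M)` go under `Pᴴ` to unit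
  ground states of `H` in `(2|Λ| - N, -M)`.

These are Literature-side ports (generalising the tree's `groundEnergy_particleHole_transfer`, which treats the `N`-sectors
`IsNParticle` only) of the Summits-side `Summits/HubbardSuperconductivity/HubbardLadder/PairCorrParticleHoleSectors.lean` §1, which
cannot be imported under `Literature/`. Everything is PROVED; no definition, no named fact, no sorry. Consumed by
`TorusGroundStateParticleHole` (the record `T = 0` class under `α`).

## References
* E. H. Lieb, F. Y. Wu, Physica A 321 (2003) 1, §1 eq. (3) (`E(M, M') = -(N_a - N)U + E(N_a - M, N_a - M')`). [cite: LiebWuPhysicaA2003, §1 eq. (3)]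
* E. H. Lieb, PRL 62 (1989) 1201, Remark (2) (the particle–hole map of the spin sectors). [cite: LiebPRL1989, Remark (2)]
* H. Tasaki (2020), §9.3.3. [cite: Tasaki2020, §9.3.3]

## Mathlib / tree search
REUSED: `particleHole_mul_numberAt_mul_conjTranspose_holds`, `particleHole_mulVec_apply`, `particleHole_conjTranspose_mulVec_apply`,
`particleHole_mul_conjTranspose`, `particleHole_conjTranspose_mul`, `card_orb`, `totalNumber_mulVec_of_isNParticle`
(`HubbardModelParticleHoleProofs`); `LiebThm1.neg_sum_norm_le_re_expect` (`HubbardWave0LiebProofs`); `mem_szSector_iff`,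
`IsGroundStateInSector`, `Matrix.minEnergyOn` (`HubbardModel`, `FinDimSpectrum`); `OrderIso.map_csInf'` (Mathlib).
`lean search 'minEnergyOn.*particleHole|isGroundStateInSector.*particleHole'` under `Literature/`: only the `IsNParticle`-sector
transfer `groundEnergy_particleHole_transfer` (`HubbardNNNHoppingParticleHole`).
-/

noncomputable section

namespace Literature.MathematicalPhysics.QuantumLattice

open Matrix Finset HubbardWave0 Literature.Probability.LatticeModels
open scoped ComplexOrder BigOperators

section GroundStates

variable {Λ : Type*} [LinearOrder Λ] [Fintype Λ]

/-- **`P S^z Pᴴ = -S^z`**: the full particle–hole transformation reverses the magnetisation (`n_{xσ} ↦ 1 - n_{xσ}`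
for both spins). [cite: LiebPRL1989, Remark (2)] -/
theorem particleHole_mul_spinZ_mul_conjTranspose (ε : Orb Λ → ℂ) (hε : ∀ i, ‖ε i‖ = 1) :
    particleHole ε * spinZ * (particleHole ε)ᴴ = -spinZ := by
  have hnum : ∀ (x : Λ) (σ : Fin 2), particleHole ε * numberOp x σ * (particleHole ε)ᴴ = 1 - numberOp x σ :=
    fun x σ => particleHole_mul_numberAt_mul_conjTranspose_holds ε hε (orb x σ)
  unfold HubbardWave0.spinZ
  rw [Matrix.mul_smul, Matrix.smul_mul, Finset.mul_sum, Finset.sum_mul, ← smul_neg, ← Finset.sum_neg_distrib]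
  congr 1
  refine Finset.sum_congr rfl fun x _ => ?_
  rw [Matrix.mul_sub, Matrix.sub_mul, hnum, hnum]
  abel

/-- `⟨Pᴴψ, Pᴴφ⟩ = ⟨ψ, φ⟩` (unimodular phases: `P Pᴴ = 1`). [cite: Tasaki2020, §9.3.3] -/
theorem star_conjTranspose_particleHole_mulVec_dotProduct (ε : Orb Λ → ℂ) (hε : ∀ i, ‖ε i‖ = 1)
    (ψ φ : Fock (Orb Λ)) :
    star ((particleHole ε)ᴴ *ᵥ ψ) ⬝ᵥ ((particleHole ε)ᴴ *ᵥ φ) = star ψ ⬝ᵥ φ := by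
  rw [star_mulVec, conjTranspose_conjTranspose, ← dotProduct_mulVec, mulVec_mulVec,
    particleHole_mul_conjTranspose ε hε, one_mulVec]

/-- **`Pᴴ` carries the joint sector `(N, S^z = M)` into `(2|Λ| - N, S^z = -M)`.** [cite: LiebPRL1989, Remark (2)] -/
theorem conjTranspose_particleHole_mulVec_mem_szSector (ε : Orb Λ → ℂ) (hε : ∀ i, ‖ε i‖ = 1) {N : ℕ} {M : ℝ}
    {ψ : Fock (Orb Λ)} (hψ : ψ ∈ szSector N M) :
    (particleHole ε)ᴴ *ᵥ ψ ∈ szSector (2 * Fintype.card Λ - N) (-M) := by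
  rw [mem_szSector_iff] at hψ ⊢
  obtain ⟨hN, hS⟩ := hψ
  refine ⟨?_, ?_⟩
  · intro s hs
    rw [particleHole_conjTranspose_mulVec_apply]
    have hc : sᶜ.card ≠ N := by
      rw [Finset.card_compl, card_orb]
      have := s.card_le_univ
      rw [card_orb] at this
      omega
    rw [hN _ hc, mul_zero]
  · have hcomm : HubbardWave0.spinZ * (particleHole ε)ᴴ = -((particleHole ε)ᴴ * HubbardWave0.spinZ) := by
      have h := congrArg (fun X => (particleHole ε)ᴴ * X) (particleHole_mul_spinZ_mul_conjTranspose ε hε)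
      simp only [← Matrix.mul_assoc, particleHole_conjTranspose_mul ε hε, Matrix.one_mul, Matrix.mul_neg] at h
      exact h
    rw [mulVec_mulVec, hcomm, Matrix.neg_mulVec, ← mulVec_mulVec, hS, mulVec_smul, Complex.ofReal_neg, neg_smul]

/-- **`P` carries the joint sector `(N, S^z = M)` into `(2|Λ| - N, S^z = -M)`** (the inverse direction).
[cite: LiebPRL1989, Remark (2)] -/
theorem particleHole_mulVec_mem_szSector (ε : Orb Λ → ℂ) (hε : ∀ i, ‖ε i‖ = 1) {N : ℕ} {M : ℝ}
    {φ : Fock (Orb Λ)} (hφ : φ ∈ szSector N M) :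
    particleHole ε *ᵥ φ ∈ szSector (2 * Fintype.card Λ - N) (-M) := by
  rw [mem_szSector_iff] at hφ ⊢
  obtain ⟨hN, hS⟩ := hφ
  refine ⟨?_, ?_⟩
  · intro s hs
    rw [particleHole_mulVec_apply]
    have hc : sᶜ.card ≠ N := by
      rw [Finset.card_compl, card_orb]
      have := s.card_le_univ
      rw [card_orb] at this
      omega
    rw [hN _ hc, mul_zero]
  · have hcomm : HubbardWave0.spinZ * particleHole ε = -(particleHole ε * HubbardWave0.spinZ) := by
      have h := congrArg (fun X => X * particleHole ε) (particleHole_mul_spinZ_mul_conjTranspose ε hε)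
      simp only [Matrix.mul_assoc, particleHole_conjTranspose_mul ε hε, Matrix.mul_one, Matrix.neg_mul] at h
      rw [h, neg_neg]
    rw [mulVec_mulVec, hcomm, Matrix.neg_mulVec, ← mulVec_mulVec, hS, mulVec_smul, Complex.ofReal_neg, neg_smul]

/-- `H (Pᴴψ) = Pᴴ (H'ψ) + (c - U N) Pᴴψ` on `N`-particle vectors, for unimodular phases and `P H Pᴴ = H' - U N + c`.
[cite: LiebWuPhysicaA2003, §1 eq. (3)] -/
theorem mulVec_conjTranspose_particleHole_mulVec_of_conj (ε : Orb Λ → ℂ) (hε : ∀ i, ‖ε i‖ = 1)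
    {H H' : Matrix (Finset (Orb Λ)) (Finset (Orb Λ)) ℂ} {U c : ℝ}
    (hconj : particleHole ε * H * (particleHole ε)ᴴ =
      H' - (U : ℂ) • totalNumber + (c : ℂ) • (1 : Matrix (Finset (Orb Λ)) (Finset (Orb Λ)) ℂ))
    {N : ℕ} {ψ : Fock (Orb Λ)} (hψ : IsNParticle N ψ) :
    H *ᵥ ((particleHole ε)ᴴ *ᵥ ψ) =
      (particleHole ε)ᴴ *ᵥ (H' *ᵥ ψ) + ((c - U * N : ℝ) : ℂ) • ((particleHole ε)ᴴ *ᵥ ψ) := by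
  have hHP : H * (particleHole ε)ᴴ = (particleHole ε)ᴴ * (H' - (U : ℂ) • totalNumber + (c : ℂ) • 1) := by
    rw [← hconj, ← Matrix.mul_assoc, ← Matrix.mul_assoc, particleHole_conjTranspose_mul ε hε, Matrix.one_mul]
  rw [mulVec_mulVec, hHP, ← mulVec_mulVec, add_mulVec, sub_mulVec, smul_mulVec, smul_mulVec, one_mulVec,
    totalNumber_mulVec_of_isNParticle hψ, mulVec_add, mulVec_sub, mulVec_smul, mulVec_smul, mulVec_smul, smul_smul]
  have hc : ((c - U * N : ℝ) : ℂ) = (c : ℂ) - (U : ℂ) * (N : ℂ) := by push_cast; ring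
  rw [hc, sub_smul]
  abel

/-- Rayleigh quotients: `re ⟨Pᴴψ, H Pᴴψ⟩ = re ⟨ψ, H'ψ⟩ + (c - U N)` for unit `N`-particle `ψ`.
[cite: LiebWuPhysicaA2003, §1 eq. (3)] -/
theorem re_rayleigh_conjTranspose_particleHole_mulVec_of_conj (ε : Orb Λ → ℂ) (hε : ∀ i, ‖ε i‖ = 1)
    {H H' : Matrix (Finset (Orb Λ)) (Finset (Orb Λ)) ℂ} {U c : ℝ}
    (hconj : particleHole ε * H * (particleHole ε)ᴴ =
      H' - (U : ℂ) • totalNumber + (c : ℂ) • (1 : Matrix (Finset (Orb Λ)) (Finset (Orb Λ)) ℂ))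
    {N : ℕ} {ψ : Fock (Orb Λ)} (hψ : IsNParticle N ψ) (h1 : star ψ ⬝ᵥ ψ = 1) :
    (star ((particleHole ε)ᴴ *ᵥ ψ) ⬝ᵥ H *ᵥ ((particleHole ε)ᴴ *ᵥ ψ)).re =
      (star ψ ⬝ᵥ H' *ᵥ ψ).re + (c - U * N) := by
  rw [mulVec_conjTranspose_particleHole_mulVec_of_conj ε hε hconj hψ, dotProduct_add, dotProduct_smul,
    star_conjTranspose_particleHole_mulVec_dotProduct ε hε, star_conjTranspose_particleHole_mulVec_dotProduct ε hε,
    h1, smul_eq_mul, mul_one, Complex.add_re, Complex.ofReal_re]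

/-- **Sector energies under the pair `P H Pᴴ = H' - U N + c`:**
`λ_min^H(2|Λ| - N, -M) = λ_min^{H'}(N, M) + (c - U N)` whenever the sector `(N, M)` contains a unit vector (both
sides are infima of real parts of Rayleigh quotients over sets of unit vectors matched by `Pᴴ`; the variational set
is translated, `OrderIso.map_csInf'`). Literature-side port of the Summits-side
`PairChannelParticleHole.minEnergyOn_szSector_of_conj` (not importable here). [cite: LiebWuPhysicaA2003, §1 eq. (3)] -/
theorem minEnergyOn_szSector_particleHole_of_conj (ε : Orb Λ → ℂ) (hε : ∀ i, ‖ε i‖ = 1)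
    {H H' : Matrix (Finset (Orb Λ)) (Finset (Orb Λ)) ℂ} {U c : ℝ}
    (hconj : particleHole ε * H * (particleHole ε)ᴴ =
      H' - (U : ℂ) • totalNumber + (c : ℂ) • (1 : Matrix (Finset (Orb Λ)) (Finset (Orb Λ)) ℂ))
    {N : ℕ} (hN : N ≤ 2 * Fintype.card Λ) (M : ℝ) (hne : ∃ φ ∈ szSector (Λ := Λ) N M, star φ ⬝ᵥ φ = 1) :
    H.minEnergyOn (szSector (2 * Fintype.card Λ - N) (-M)) = H'.minEnergyOn (szSector N M) + (c - U * N) := by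
  set d : ℝ := c - U * N with hd
  set S : Set ℝ := {E : ℝ | ∃ ψ ∈ szSector (Λ := Λ) N M,
      star ψ ⬝ᵥ ψ = 1 ∧ E = (star ψ ⬝ᵥ H' *ᵥ ψ).re} with hS
  set S' : Set ℝ := {E : ℝ | ∃ ψ ∈ szSector (Λ := Λ) (2 * Fintype.card Λ - N) (-M),
      star ψ ⬝ᵥ ψ = 1 ∧ E = (star ψ ⬝ᵥ H *ᵥ ψ).re} with hS'
  have hset : S' = (OrderIso.addRight d) '' S := by
    ext E
    simp only [hS, hS', Set.mem_image, OrderIso.addRight_apply, Set.mem_setOf_eq]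
    constructor
    · rintro ⟨φ, hφ, h1, rfl⟩
      have hmem := particleHole_mulVec_mem_szSector ε hε hφ
      rw [show 2 * Fintype.card Λ - (2 * Fintype.card Λ - N) = N by omega, neg_neg] at hmem
      have hψN : IsNParticle N (particleHole ε *ᵥ φ) := ((mem_szSector_iff _ _ _).1 hmem).1
      have hψ1 : star (particleHole ε *ᵥ φ) ⬝ᵥ (particleHole ε *ᵥ φ) = 1 := by
        rw [star_mulVec, ← dotProduct_mulVec, mulVec_mulVec, particleHole_conjTranspose_mul ε hε, one_mulVec, h1]
      have hback : (particleHole ε)ᴴ *ᵥ (particleHole ε *ᵥ φ) = φ := by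
        rw [mulVec_mulVec, particleHole_conjTranspose_mul ε hε, one_mulVec]
      have h := re_rayleigh_conjTranspose_particleHole_mulVec_of_conj ε hε hconj hψN hψ1
      rw [hback] at h
      exact ⟨_, ⟨_, hmem, hψ1, rfl⟩, by rw [h, hd]⟩
    · rintro ⟨E, ⟨ψ, hψ, h1, rfl⟩, rfl⟩
      have hψN : IsNParticle N ψ := ((mem_szSector_iff _ _ _).1 hψ).1
      exact ⟨_, conjTranspose_particleHole_mulVec_mem_szSector ε hε hψ,
        by rw [star_conjTranspose_particleHole_mulVec_dotProduct ε hε, h1],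
        by rw [re_rayleigh_conjTranspose_particleHole_mulVec_of_conj ε hε hconj hψN h1, hd]⟩
  have hSne : S.Nonempty := by
    obtain ⟨φ, hφ, h1⟩ := hne
    exact ⟨_, φ, hφ, h1, rfl⟩
  have hbdd : BddBelow S := by
    refine ⟨-(∑ s, ∑ t, ‖H' s t‖), ?_⟩
    rintro E ⟨φ, -, h1, rfl⟩
    exact LiebThm1.neg_sum_norm_le_re_expect H' h1
  unfold Matrix.minEnergyOn
  change sInf S' = sInf S + d
  rw [hset, ← OrderIso.map_csInf' _ hSne hbdd, OrderIso.addRight_apply]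

/-- **Joint-sector ground states under the pair `P H Pᴴ = H' - U N + c`.** If `ψ` is a unit ground state of `H'`
in the sector `(N, S^z = M)` (`N ≤ 2|Λ|`), then `Pᴴψ` is a (unit) ground state of `H` in `(2|Λ| - N, S^z = -M)`.
Literature-side port of the Summits-side `PairChannelParticleHole.isGroundStateInSector_conjTranspose_mulVec_of_conj`.
[cite: LiebWuPhysicaA2003, §1 eq. (3)] -/
theorem isGroundStateInSector_conjTranspose_particleHole_mulVec_of_conj (ε : Orb Λ → ℂ) (hε : ∀ i, ‖ε i‖ = 1)
    {H H' : Matrix (Finset (Orb Λ)) (Finset (Orb Λ)) ℂ} {U c : ℝ}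
    (hconj : particleHole ε * H * (particleHole ε)ᴴ =
      H' - (U : ℂ) • totalNumber + (c : ℂ) • (1 : Matrix (Finset (Orb Λ)) (Finset (Orb Λ)) ℂ))
    {N : ℕ} (hN : N ≤ 2 * Fintype.card Λ) {M : ℝ} {ψ : Fock (Orb Λ)}
    (hψ : IsGroundStateInSector H' N M ψ) (h1 : star ψ ⬝ᵥ ψ = 1) :
    IsGroundStateInSector H (2 * Fintype.card Λ - N) (-M) ((particleHole ε)ᴴ *ᵥ ψ) := by
  obtain ⟨hmem, hne0, heig⟩ := hψ
  have hψN : IsNParticle N ψ := ((mem_szSector_iff _ _ _).1 hmem).1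
  refine ⟨conjTranspose_particleHole_mulVec_mem_szSector ε hε hmem, ?_, ?_⟩
  · intro h0
    have h := star_conjTranspose_particleHole_mulVec_dotProduct ε hε ψ ψ
    rw [h0, h1, dotProduct_zero] at h
    exact zero_ne_one h
  · rw [mulVec_conjTranspose_particleHole_mulVec_of_conj ε hε hconj hψN, heig, mulVec_smul, ← add_smul,
      ← Complex.ofReal_add, minEnergyOn_szSector_particleHole_of_conj ε hε hconj hN M ⟨ψ, hmem, h1⟩]

end GroundStates

end Literature.MathematicalPhysics.QuantumLattice
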